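import Literature.Analysis.FluidPDE.LocalTypeIScaling
import HarnessLib

/-!
# Scaling out a local `L³` trace: the critical rescaling concentrates no `L³`-mass

Analysis/FluidPDE proofs-layer file (theorems only; no definitions, no named facts).

The blow-up (zoom-in) procedure at a space–time point `(x₀, T)` of a Navier–Stokes solution
replaces the terminal value `V = v(·, T)` by its critically rescaled translates
`V_λ(y) = λ V(x₀ + λ y)`, `λ ↓ 0`. On a fixed ball `B(0, a)` one has the exact identity
`‖V_λ‖_{L³(B(0,a))} = ‖V‖_{L³(B(x₀, λ a))}` (criticality of `L³`), and more generally
`∫_{B(0,a)} |V_λ|^q dy = λ^{q-3} ∫_{B(x₀,λa)} |V|^q dx`; hence, if `V ∈ L³(B(x₀, ρ))` for some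
`ρ > 0`, then `‖V_λ‖_{L³(B(0,a))} → 0` as `λ ↓ 0` for every `a` (absolute continuity of the
integral on shrinking balls). This is the step by which a blow-up limit generated at a point where
the terminal value is locally in `L³` has ZERO top-time trace (Escauriaza–Seregin–Šverák 2003;
Seregin, Lecture Notes 2014, §6.6, p. 127: the identity
`a^{-15/8} ∫_{B(a)} |u^{(k)}(y,0)|^{9/8} dy = (λ_k a)^{-15/8} ∫_{B(λ_k a)} |v(x,0)|^{9/8} dx` and
"(6.6.2) ⇒ (6.6.3) `u(·,0) = 0`"; here in the `L³` form used by the registered line `extinct-apex`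
of item stmt-NavierStokesRegularity-18385, stub `stub_extinctApex_of_L3trace`, hypothesis
`MemLp (u T) 3 (volume.restrict (ball x₀ ρ))`).

* `setLIntegral_ball_enorm_rpow_zoomTrace` — the change of variables on balls, any exponent
  `q ≥ 0`;
* `eLpNorm_three_zoomTrace_restrict_ball` — `‖λ V(x₀ + λ ·)‖_{L³(B(0,a))} = ‖V‖_{L³(B(x₀,λa))}`;
* `tendsto_eLpNorm_restrict_ball_nhdsGT_zero` — `‖V‖_{L^p(B(x₀,r))} → 0` as `r ↓ 0` when
  `V ∈ L^p(B(x₀,ρ))`, `0 < p < ∞`;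
* `tendsto_eLpNorm_three_zoomTrace_nhdsGT_zero` — `‖λ V(x₀ + λ ·)‖_{L³(B(0,a))} → 0` as `λ ↓ 0`.

The whole-space versions (`eLpNorm_three_rescaleData`, `tendsto_eLpNorm_rescaleData_sub_three`)
are in `CriticalSpaces.lean` / `ChaeAsymptoticallySelfSimilarProfileThree.lean`; the spatial
change of variables is the tree's `setLIntegral_preimage_comp_space_affine`.

## References

* G. Seregin, *Lecture Notes on Regularity Theory for the Navier–Stokes Equations*, World
  Scientific (2014), §6.6, p. 127 ((6.6.2) ⇒ (6.6.3)), Prop. 6.20. [Seregin2014Notes]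
* L. Escauriaza, G. Seregin, V. Šverák, *`L_{3,∞}`-solutions of Navier–Stokes equations and
  backward uniqueness*, Russian Math. Surveys 58 (2003), §5 (scaling and the blow-up limit's zero
  trace at the final time). [EscauriazaSereginSverak2003]
-/

noncomputable section

open MeasureTheory Set Function Filter Topology TopologicalSpace Metric
open scoped NNReal ENNReal

namespace Literature.Analysis.FluidPDE

section ScalingOut

variable {F : Type*} [NormedAddCommGroup F] [NormedSpace ℝ F]

/-- **Change of variables on balls for the critical rescaling**: for `λ > 0`, `q ≥ 0`,
`∫_{B(0,a)} ‖λ V(x₀ + λ y)‖^q dy = λ^q (λ³)⁻¹ ∫_{B(x₀, λ a)} ‖V(x)‖^q dx` (Seregin 2014, §6.6,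
p. 127, the display before "(6.6.2) ⇒ (6.6.3)", there with `q = 9/8`).
[cite: Seregin2014Notes, §6.6 p. 127 (display after (6.6.3))] -/
theorem setLIntegral_ball_enorm_rpow_zoomTrace (x₀ : EuclideanSpace ℝ (Fin 3))
    (V : EuclideanSpace ℝ (Fin 3) → F) {c : ℝ} (hc : 0 < c) (a : ℝ) {q : ℝ} (hq : 0 ≤ q) :
    ∫⁻ y in ball (0 : EuclideanSpace ℝ (Fin 3)) a, ‖c • V (x₀ + c • y)‖ₑ ^ q =
      ENNReal.ofReal (c ^ q * (c ^ 3)⁻¹) *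
        ∫⁻ x in ball x₀ (c * a), ‖V x‖ₑ ^ q := by
  have hpre := space_affine_preimage_ball_zoom hc x₀ 0 a
  rw [smul_zero, add_zero] at hpre
  rw [← hpre]
  have hF : (fun y : EuclideanSpace ℝ (Fin 3) => ‖c • V (x₀ + c • y)‖ₑ ^ q) =
      fun y => (fun x => ENNReal.ofReal c ^ q * ‖V x‖ₑ ^ q) (x₀ + c • y) := by
    funext y
    simp only [enorm_smul, Real.enorm_eq_ofReal hc.le]
    rw [ENNReal.mul_rpow_of_nonneg _ _ hq]
  rw [show (∫⁻ y in (fun x : EuclideanSpace ℝ (Fin 3) => x₀ + c • x) ⁻¹' ball x₀ (c * a),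
      ‖c • V (x₀ + c • y)‖ₑ ^ q) = ∫⁻ y in (fun x : EuclideanSpace ℝ (Fin 3) => x₀ + c • x) ⁻¹'
        ball x₀ (c * a), (fun x => ENNReal.ofReal c ^ q * ‖V x‖ₑ ^ q) (x₀ + c • y) from by rw [hF],
    setLIntegral_preimage_comp_space_affine (E := EuclideanSpace ℝ (Fin 3)) hc x₀
      (fun x => ENNReal.ofReal c ^ q * ‖V x‖ₑ ^ q) (ball x₀ (c * a)), finrank_euclideanSpace_fin,
    lintegral_const_mul' _ _ (ENNReal.rpow_ne_top_of_nonneg hq ENNReal.ofReal_ne_top),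
    ← mul_assoc, ENNReal.ofReal_rpow_of_nonneg hc.le hq, ← ENNReal.ofReal_mul (by positivity),
    mul_comm ((c ^ 3)⁻¹)]

/-- **`L³` is critical**: `‖λ V(x₀ + λ ·)‖_{L³(B(0,a))} = ‖V‖_{L³(B(x₀, λ a))}` for `λ > 0`
(Seregin 2014, §6.6, p. 127; the whole-space identity is `eLpNorm_three_rescaleData`).
[cite: Seregin2014Notes, §6.6 p. 127 (display after (6.6.3))] -/
theorem eLpNorm_three_zoomTrace_restrict_ball (x₀ : EuclideanSpace ℝ (Fin 3))
    (V : EuclideanSpace ℝ (Fin 3) → F) {c : ℝ} (hc : 0 < c) (a : ℝ) :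
    eLpNorm (fun y => c • V (x₀ + c • y)) 3
        (volume.restrict (ball (0 : EuclideanSpace ℝ (Fin 3)) a)) =
      eLpNorm V 3 (volume.restrict (ball x₀ (c * a))) := by
  rw [eLpNorm_eq_lintegral_rpow_enorm_toReal (by norm_num) (by norm_num),
    eLpNorm_eq_lintegral_rpow_enorm_toReal (by norm_num) (by norm_num)]
  have h3 : (3 : ℝ≥0∞).toReal = 3 := by norm_num
  rw [h3, setLIntegral_ball_enorm_rpow_zoomTrace x₀ V hc a (by norm_num : (0 : ℝ) ≤ 3)]
  have hc3 : c ^ (3 : ℝ) * (c ^ 3)⁻¹ = 1 := by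
    have e : c ^ (3 : ℝ) = c ^ (3 : ℕ) := by exact_mod_cast Real.rpow_natCast c 3
    rw [e, mul_inv_cancel₀ (pow_ne_zero 3 hc.ne')]
  rw [hc3, ENNReal.ofReal_one, one_mul]

omit [NormedSpace ℝ F] in
/-- **Absolute continuity on shrinking balls**: if `V ∈ L^p(B(x₀, ρ))` for some `ρ > 0` and
`0 < p < ∞`, then `‖V‖_{L^p(B(x₀, r))} → 0` as `r ↓ 0` (the measure of `B(x₀, r)` tends to `0`;
Seregin 2014, §6.6, (6.6.2) for `v(·,0) ∈ L³`). [cite: Seregin2014Notes, §6.6 p. 127 (6.6.2)] -/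
theorem tendsto_eLpNorm_restrict_ball_nhdsGT_zero {V : EuclideanSpace ℝ (Fin 3) → F}
    {x₀ : EuclideanSpace ℝ (Fin 3)} {ρ : ℝ} (hρ : 0 < ρ) {p : ℝ≥0∞} (hp0 : p ≠ 0) (hpt : p ≠ ⊤)
    (hV : MemLp V p (volume.restrict (ball x₀ ρ))) :
    Tendsto (fun r : ℝ => eLpNorm V p (volume.restrict (ball x₀ r))) (𝓝[>] 0) (𝓝 0) := by
  have hp' : 0 < p.toReal := ENNReal.toReal_pos hp0 hpt
  -- finiteness of `∫_{B(x₀,ρ)} ‖V‖^p`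
  have hfin : ∫⁻ x in ball x₀ ρ, ‖V x‖ₑ ^ p.toReal ≠ ⊤ :=
    (lintegral_rpow_enorm_lt_top_of_eLpNorm_lt_top hp0 hpt hV.eLpNorm_lt_top).ne
  -- the measure of the small balls tends to zero
  have hmeas : Tendsto ((volume.restrict (ball x₀ ρ)) ∘ fun r : ℝ => ball x₀ r) (𝓝[>] 0) (𝓝 0) := by
    have hup : Tendsto (fun r : ℝ => ENNReal.ofReal (r ^ 3) *
        volume (ball (0 : EuclideanSpace ℝ (Fin 3)) 1)) (𝓝[>] 0) (𝓝 0) := by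
      have h0 : Tendsto (fun r : ℝ => ENNReal.ofReal (r ^ 3)) (𝓝[>] (0 : ℝ)) (𝓝 0) := by
        have h := ENNReal.tendsto_ofReal (((continuous_pow 3).tendsto (0 : ℝ)).mono_left
          (nhdsWithin_le_nhds (s := Ioi (0 : ℝ))))
        simpa using h
      have h := ENNReal.Tendsto.mul_const h0 (Or.inr
        (measure_ball_lt_top (μ := (volume : Measure (EuclideanSpace ℝ (Fin 3))))
          (x := 0) (r := 1)).ne)
      rwa [zero_mul] at h
    refine tendsto_of_tendsto_of_tendsto_of_le_of_le' tendsto_const_nhds hup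
      (Eventually.of_forall fun _ => bot_le) ?_
    filter_upwards [eventually_mem_nhdsWithin] with r hr
    calc ((volume.restrict (ball x₀ ρ)) ∘ fun r : ℝ => ball x₀ r) r
        = (volume.restrict (ball x₀ ρ)) (ball x₀ r) := rfl
      _ ≤ volume (ball x₀ r) := Measure.restrict_apply_le _ _
      _ = ENNReal.ofReal (r ^ 3) * volume (ball (0 : EuclideanSpace ℝ (Fin 3)) 1) := by
          rw [Measure.addHaar_ball_of_pos volume x₀ (mem_Ioi.1 hr), finrank_euclideanSpace_fin]
  have h1 := tendsto_setLIntegral_zero (μ := volume.restrict (ball x₀ ρ)) hfin hmeas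
  -- for `0 < r < ρ` the doubly restricted integral is the integral over `B(x₀, r)`
  have h2 : Tendsto (fun r : ℝ => ∫⁻ x in ball x₀ r, ‖V x‖ₑ ^ p.toReal) (𝓝[>] 0) (𝓝 0) := by
    refine h1.congr' ?_
    filter_upwards [Ioo_mem_nhdsGT hρ] with r hr
    rw [Measure.restrict_restrict measurableSet_ball,
      inter_eq_left.2 (ball_subset_ball hr.2.le)]
  -- take the `1/p`-th power
  have h3 : Tendsto (fun r : ℝ => (∫⁻ x in ball x₀ r, ‖V x‖ₑ ^ p.toReal) ^ (1 / p.toReal))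
      (𝓝[>] 0) (𝓝 0) := by
    have h := ((ENNReal.continuous_rpow_const (y := 1 / p.toReal)).tendsto 0).comp h2
    rwa [ENNReal.zero_rpow_of_pos (by positivity)] at h
  refine h3.congr' (Eventually.of_forall fun r => ?_)
  exact (eLpNorm_eq_lintegral_rpow_enorm_toReal hp0 hpt).symm

/-- **Scaling out a local `L³` trace.** If `V ∈ L³(B(x₀, ρ))` for some `ρ > 0`, then for every
`a > 0` the critically rescaled translates `V_λ(y) = λ V(x₀ + λ y)` satisfy
`‖V_λ‖_{L³(B(0,a))} = ‖V‖_{L³(B(x₀, λ a))} → 0` as `λ ↓ 0`: the blow-up limit generated at `(x₀, T)`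
from a terminal value locally in `L³` has zero trace at the top time (Seregin 2014, §6.6, p. 127,
(6.6.2) ⇒ (6.6.3); Escauriaza–Seregin–Šverák 2003, §5).
[cite: Seregin2014Notes, §6.6 p. 127 ((6.6.2) ⇒ (6.6.3))] -/
theorem tendsto_eLpNorm_three_zoomTrace_nhdsGT_zero {V : EuclideanSpace ℝ (Fin 3) → F}
    {x₀ : EuclideanSpace ℝ (Fin 3)} {ρ : ℝ} (hρ : 0 < ρ)
    (hV : MemLp V 3 (volume.restrict (ball x₀ ρ))) {a : ℝ} (ha : 0 < a) :
    Tendsto (fun c : ℝ => eLpNorm (fun y => c • V (x₀ + c • y)) 3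
      (volume.restrict (ball (0 : EuclideanSpace ℝ (Fin 3)) a))) (𝓝[>] 0) (𝓝 0) := by
  have h1 := tendsto_eLpNorm_restrict_ball_nhdsGT_zero hρ (by norm_num) (by norm_num) hV
  have h2 : Tendsto (fun c : ℝ => c * a) (𝓝[>] (0 : ℝ)) (𝓝[>] 0) := by
    refine tendsto_nhdsWithin_iff.2 ⟨?_, ?_⟩
    · have h : Tendsto (fun c : ℝ => c * a) (𝓝 0) (𝓝 (0 * a)) := tendsto_id.mul_const a
      rw [zero_mul] at h
      exact h.mono_left nhdsWithin_le_nhds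
    · exact eventually_mem_nhdsWithin.mono fun c hc => mul_pos hc ha
  refine (h1.comp h2).congr' ?_
  filter_upwards [eventually_mem_nhdsWithin] with c hc
  exact (eLpNorm_three_zoomTrace_restrict_ball x₀ V (mem_Ioi.1 hc) a).symm

/-- Sequential form: along any sequence of scales `λ_k ↓ 0` (`λ_k > 0`),
`‖λ_k V(x₀ + λ_k ·)‖_{L³(B(0,a))} → 0` (Seregin 2014, Prop. 6.20 / §6.6: the zoom sequence
`u^{(k)}(y,s) = λ_k v(λ_k y, λ_k² s)`). [cite: Seregin2014Notes, §6.6 p. 127 ((6.6.2) ⇒ (6.6.3))] -/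
theorem tendsto_eLpNorm_three_zoomTrace_seq_zero {V : EuclideanSpace ℝ (Fin 3) → F}
    {x₀ : EuclideanSpace ℝ (Fin 3)} {ρ : ℝ} (hρ : 0 < ρ)
    (hV : MemLp V 3 (volume.restrict (ball x₀ ρ))) {a : ℝ} (ha : 0 < a) {c : ℕ → ℝ}
    (hpos : ∀ k, 0 < c k) (hlim : Tendsto c atTop (𝓝 0)) :
    Tendsto (fun k => eLpNorm (fun y => c k • V (x₀ + c k • y)) 3
      (volume.restrict (ball (0 : EuclideanSpace ℝ (Fin 3)) a))) atTop (𝓝 0) :=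
  (tendsto_eLpNorm_three_zoomTrace_nhdsGT_zero hρ hV ha).comp
    (tendsto_nhdsWithin_iff.2 ⟨hlim, Eventually.of_forall fun k => mem_Ioi.2 (hpos k)⟩)

end ScalingOut

end Literature.Analysis.FluidPDE
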